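/-
Origin: expansion seat `prover-pub-hodgecm-mc-binder-2-g11-0`, handover #46 2026-08-20T03:56Z md5 7a7914d8c3ab (145 l.; CERTIFIED rc 0 / 0 warn / 23.1 s; imports #45 `PlaceEigen` + #44 `VLetterIota`; install after both; DATUM-LEVEL per-place inputs `hd` of #42 for the `K_V`-letters `((A,D),(1,1))`, places indexed as `cmPlacesEquiv L b` (frames and letter over the same place, no transport): **`linSubst_kV_placePoly_of_eq_sigmaPos`** (datum `sigmaPos eA …` ⇒ EVERY place polynomial FIXED; #45 + #15 `linSubst_star_dualPairι_kV_rename_P_pow` through `cmIdx_eq_pairFrame`/`linSubst_star_reindexUnitary_rename`), **`linSubst_kV_placePoly_of_eq_iota`** (datum `iota ((pairFrame)⁻¹ ∘ planeToDPIdx eA eR q₀)` ⇒ scaled by `det(A read through eA)`; #45 + #44); + `linSubst_kV_placePoly_of_eq_iotaS` (S-reading, conj); missing twin for g12: `sigmaNeg` (needs the #15-twin for `mixedToDPIdxNeg`); NAME LIST `HodgeCM.Model.HypCensus.linSubst_kV_placePoly_of_eq_sigmaPos`, `HodgeCM.Model.HypCensus.linSubst_kV_placePoly_of_eq_iota`;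 axioms: no new) (`HOME/mc/pub-hodgecm-mc-binder-2/g11/pkg/HodgeCM/Model/HypCensus/VLetterSigma.lean`, md5 7a7914d8c3ab, 145 lines);
landed by the second packager p2 gen 2 (p2-g2) in gate run 40 as `HodgeCM/Model/HypCensus/VLetterSigma.lean` (verbatim).
-/
/-
Origin: speedrun cell pub-hodgecm, MODEL-CONSTRUCTION sub-cell, lineage mc-binder-2 (BINDER-OWNERS rows 18/19: E binders
`hyp12` / `hyp34` of `Model.perL_picardCM_r15A`), seat prover-pub-hodgecm-mc-binder-2-g11-0 (gen 11), 2026-08-20.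
Target in PKG: `HodgeCM/Model/HypCensus/VLetterSigma.lean` (NEW additive leaf; imports this lineage's `HypCensus/PlaceEigen` (#45),
`HypCensus/VLetterIota` (#44; brings #36 `cmIdx_eq_pairFrame`, #32 `linSubst_star_reindexUnitary_rename`, #15 `KTypeDictionary`)).
KERNEL ONLY: 0 records, nothing cited as hypothesis, 0 `def … : Prop`; theorems only.
-/
import Summits.HodgeConjecture.HodgeCM.Model.HypCensus.PlaceEigen
import Summits.HodgeConjecture.HodgeCM.Model.HypCensus.VLetterIota

/-!
# Census kit (rows A12/A34), (J-x₀) step (d) at the DATUM level: `K_V`-letters fix / scale the place polynomials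

Per-place inputs `hd` of #42 `cmPairRepTwist_letterSection_ins_tprod_of_eigen` for the `K_V`-letters `((A, D), (1, 1))`, for EVERY
printed pure tensor, at a place indexed as `cmPlacesEquiv L b` (so that the datum's frames and the letter live over the same place):

* **`linSubst_kV_placePoly_of_eq_sigmaPos`** — datum `sigmaPos eA …` ⇒ eigenvalue `1` (#45 + #15 `linSubst_star_dualPairι_kV_rename_P_pow`
  transported through `cmIdx_eq_pairFrame` / `linSubst_star_reindexUnitary_rename`);
* **`linSubst_kV_placePoly_of_eq_iota`** — datum `iota ((pairFrame)⁻¹ ∘ planeToDPIdx eA eR q₀)` ⇒ eigenvalue `det (A read through eA)`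
  (#45 + #44), and the `S`-reading twin **`linSubst_kV_placePoly_of_eq_iotaS`** (eigenvalue with `conj`).

(`sigmaNeg`: the #15-twin `…_kV_rename_P_pow` for `mixedToDPIdxNeg` is the one missing polynomial fact — next leaf; `delta`: #43, every `M`.)
Nothing here is a claim of PerL/QW8.
-/

set_option autoImplicit false

noncomputable section

open NumberField NumberField.InfinitePlace
open scoped Classical
open MvPolynomial
open Literature.NumberTheory.Automorphic Literature.NumberTheory.Automorphic.UnitaryGroup Literature.NumberTheory.Weil1964
open Literature.RepresentationTheory.KonnoKonno2007 Literature.RepresentationTheory.KonnoKonno2007.RealDualPair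
open Literature.NumberTheory.GelbartRogawski1991 Literature.NumberTheory.GelbartRogawski1991.UnitaryDualPair
open Literature.Analysis.SegalBargmann
open HodgeCM.PerL34.Fock HodgeCM.PerL34.Fock.PrintDict

namespace HodgeCM.Model.HypCensus

section Datum

variable (L : Type) [Field L] [NumberField L] [IsCMField L]
variable (dV : Fin 3 → L) (hdV : ∀ i, IsCMField.complexConj L (dV i) = dV i)
variable (dW : Fin 2 → L) (hdW : ∀ i, IsCMField.complexConj L (dW i) = dW i) (ι₁ : L →+* ℂ)
variable (datum : ∀ b : InfinitePlace L, PlaceDatum L dV hdV dW hdW ι₁ (cmPlacesEquiv L b)) (m₁ m₂ : InfinitePlace L → ℤ)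

/-- **Σ₁₂ place read positive: every place polynomial is FIXED by every `K_V`-letter `((A,D),(1,1))`.** -/
theorem linSubst_kV_placePoly_of_eq_sigmaPos (b : InfinitePlace L)
    (eA : Fin 3 ≃ PosIdx (cmXV L dV hdV ι₁ (cmPlacesEquiv L b))) (hQ : IsEmpty (NegIdx (cmXV L dV hdV ι₁ (cmPlacesEquiv L b))))
    (r₀ : PosIdx (cmXW L dV dW hdW ι₁ (cmPlacesEquiv L b))) (s₀ : NegIdx (cmXW L dV dW hdW ι₁ (cmPlacesEquiv L b)))
    (hR : Subsingleton (PosIdx (cmXW L dV dW hdW ι₁ (cmPlacesEquiv L b)))) (hS : Subsingleton (NegIdx (cmXW L dV dW hdW ι₁ (cmPlacesEquiv L b))))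
    (hσ : datum b = PlaceDatum.sigmaPos eA hQ r₀ s₀ hR hS)
    (A : Matrix.unitaryGroup (PosIdx (cmXV L dV hdV ι₁ (cmPlacesEquiv L b))) ℂ)
    (D : Matrix.unitaryGroup (NegIdx (cmXV L dV hdV ι₁ (cmPlacesEquiv L b))) ℂ)
    (m : ∀ b : InfinitePlace L, ((printPlaces (InfinitePlace L) (kindOf L dV hdV dW hdW ι₁ datum)
      (lamOf L dV hdV dW hdW ι₁ datum) (lamOf_ne_zero L dV hdV dW hdW ι₁ datum)
      (pinnedVacs (kindOf L dV hdV dW hdW ι₁ datum) m₁ m₂)).loc b).M) :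
    linSubst (star ((reindexUnitary (pairFrame (PosIdx (cmXV L dV hdV ι₁ (cmPlacesEquiv L b))) (NegIdx (cmXV L dV hdV ι₁ (cmPlacesEquiv L b)))
        (PosIdx (cmXW L dV dW hdW ι₁ (cmPlacesEquiv L b))) (NegIdx (cmXW L dV dW hdW ι₁ (cmPlacesEquiv L b))) finProdFinEquiv
        (cmEpsV L dV hdV ι₁ (cmPlacesEquiv L b)) (cmEpsW L dV dW hdW ι₁ (cmPlacesEquiv L b)))
        (dualPairι (((A, D), (1, 1)) : DPK (PosIdx (cmXV L dV hdV ι₁ (cmPlacesEquiv L b))) (NegIdx (cmXV L dV hdV ι₁ (cmPlacesEquiv L b)))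
          (PosIdx (cmXW L dV dW hdW ι₁ (cmPlacesEquiv L b))) (NegIdx (cmXW L dV dW hdW ι₁ (cmPlacesEquiv L b))))) :
          Matrix.unitaryGroup (Fin 6) ℂ) : Matrix (Fin 6) (Fin 6) ℂ))
        (placePoly L dV hdV dW hdW ι₁ datum m₁ m₂ m (cmPlacesEquiv L b)) =
      placePoly L dV hdV dW hdW ι₁ datum m₁ m₂ m (cmPlacesEquiv L b) := by
  rw [placePoly_apply]
  refine linSubst_emb_of_eq_sigmaPos L dV hdV dW hdW ι₁ _ eA hQ r₀ s₀ hR hS _ (fun k => ?_) (datum b) hσ _ (m b)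
  have hidx : ((PlaceDatum.sigmaPos eA hQ r₀ s₀ hR hS : PlaceDatum L dV hdV dW hdW ι₁ (cmPlacesEquiv L b)).idx :
      HodgeCM.PerL34.Fock.MixedVar → Fin 6) =
      (pairFrame (PosIdx (cmXV L dV hdV ι₁ (cmPlacesEquiv L b))) (NegIdx (cmXV L dV hdV ι₁ (cmPlacesEquiv L b)))
        (PosIdx (cmXW L dV dW hdW ι₁ (cmPlacesEquiv L b))) (NegIdx (cmXW L dV dW hdW ι₁ (cmPlacesEquiv L b))) finProdFinEquiv
        (cmEpsV L dV hdV ι₁ (cmPlacesEquiv L b)) (cmEpsW L dV dW hdW ι₁ (cmPlacesEquiv L b))).symm ∘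
        mixedToDPIdx (NegIdx (cmXV L dV hdV ι₁ (cmPlacesEquiv L b))) eA r₀ s₀ := by
    funext x
    change (cmIdx L dV hdV dW hdW ι₁ (cmPlacesEquiv L b)).symm (mixedToDPIdx _ eA r₀ s₀ x) = _
    rw [cmIdx_eq_pairFrame]
    rfl
  have hre : rename ((PlaceDatum.sigmaPos eA hQ r₀ s₀ hR hS : PlaceDatum L dV hdV dW hdW ι₁ (cmPlacesEquiv L b)).idx)
        (HodgeCM.PerL34.Fock.P ^ k) =
      rename (pairFrame (PosIdx (cmXV L dV hdV ι₁ (cmPlacesEquiv L b))) (NegIdx (cmXV L dV hdV ι₁ (cmPlacesEquiv L b)))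
        (PosIdx (cmXW L dV dW hdW ι₁ (cmPlacesEquiv L b))) (NegIdx (cmXW L dV dW hdW ι₁ (cmPlacesEquiv L b))) finProdFinEquiv
        (cmEpsV L dV hdV ι₁ (cmPlacesEquiv L b)) (cmEpsW L dV dW hdW ι₁ (cmPlacesEquiv L b))).symm
        (rename (mixedToDPIdx (NegIdx (cmXV L dV hdV ι₁ (cmPlacesEquiv L b))) eA r₀ s₀) (HodgeCM.PerL34.Fock.P ^ k)) := by
    rw [rename_rename]
    exact congrArg (fun j => rename j (HodgeCM.PerL34.Fock.P ^ k)) hidx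
  rw [hre, linSubst_star_reindexUnitary_rename, linSubst_star_dualPairι_kV_rename_P_pow]

/-- **ι₁ place, `W` read positive: every place polynomial is scaled by `det A` under the `K_V`-letter `((A,D),(1,1))`.** -/
theorem linSubst_kV_placePoly_of_eq_iota (b : InfinitePlace L)
    (eA : Fin 2 ≃ PosIdx (cmXV L dV hdV ι₁ (cmPlacesEquiv L b))) (eR : Fin 2 ≃ PosIdx (cmXW L dV dW hdW ι₁ (cmPlacesEquiv L b)))
    (q₀ : NegIdx (cmXV L dV hdV ι₁ (cmPlacesEquiv L b))) [Subsingleton (NegIdx (cmXV L dV hdV ι₁ (cmPlacesEquiv L b)))]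
    (hι : datum b = PlaceDatum.iota
      ((pairFrame (PosIdx (cmXV L dV hdV ι₁ (cmPlacesEquiv L b))) (NegIdx (cmXV L dV hdV ι₁ (cmPlacesEquiv L b)))
        (PosIdx (cmXW L dV dW hdW ι₁ (cmPlacesEquiv L b))) (NegIdx (cmXW L dV dW hdW ι₁ (cmPlacesEquiv L b))) finProdFinEquiv
        (cmEpsV L dV hdV ι₁ (cmPlacesEquiv L b)) (cmEpsW L dV dW hdW ι₁ (cmPlacesEquiv L b))).symm ∘
        planeToDPIdx eA eR q₀ (NegIdx (cmXW L dV dW hdW ι₁ (cmPlacesEquiv L b)))))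
    (A : Matrix.unitaryGroup (PosIdx (cmXV L dV hdV ι₁ (cmPlacesEquiv L b))) ℂ)
    (D : Matrix.unitaryGroup (NegIdx (cmXV L dV hdV ι₁ (cmPlacesEquiv L b))) ℂ)
    (m : ∀ b : InfinitePlace L, ((printPlaces (InfinitePlace L) (kindOf L dV hdV dW hdW ι₁ datum)
      (lamOf L dV hdV dW hdW ι₁ datum) (lamOf_ne_zero L dV hdV dW hdW ι₁ datum)
      (pinnedVacs (kindOf L dV hdV dW hdW ι₁ datum) m₁ m₂)).loc b).M) :
    linSubst (star ((reindexUnitary (pairFrame (PosIdx (cmXV L dV hdV ι₁ (cmPlacesEquiv L b))) (NegIdx (cmXV L dV hdV ι₁ (cmPlacesEquiv L b)))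
        (PosIdx (cmXW L dV dW hdW ι₁ (cmPlacesEquiv L b))) (NegIdx (cmXW L dV dW hdW ι₁ (cmPlacesEquiv L b))) finProdFinEquiv
        (cmEpsV L dV hdV ι₁ (cmPlacesEquiv L b)) (cmEpsW L dV dW hdW ι₁ (cmPlacesEquiv L b)))
        (dualPairι (((A, D), (1, 1)) : DPK (PosIdx (cmXV L dV hdV ι₁ (cmPlacesEquiv L b))) (NegIdx (cmXV L dV hdV ι₁ (cmPlacesEquiv L b)))
          (PosIdx (cmXW L dV dW hdW ι₁ (cmPlacesEquiv L b))) (NegIdx (cmXW L dV dW hdW ι₁ (cmPlacesEquiv L b))))) :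
          Matrix.unitaryGroup (Fin 6) ℂ) : Matrix (Fin 6) (Fin 6) ℂ))
        (placePoly L dV hdV dW hdW ι₁ datum m₁ m₂ m (cmPlacesEquiv L b)) =
      (Matrix.of fun a c : Fin 2 => (A : Matrix _ _ ℂ) (eA c) (eA a)).det • placePoly L dV hdV dW hdW ι₁ datum m₁ m₂ m (cmPlacesEquiv L b) := by
  rw [placePoly_apply]
  refine linSubst_emb_of_eq_iota L dV hdV dW hdW ι₁ _ _ _ _ ?_ (datum b) hι _ (m b)
  rw [← rename_rename, linSubst_star_reindexUnitary_rename, linSubst_star_dualPairι_kV_rename_detZ, map_smul]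

/-- **ι₁ place, `W` read negative: every place polynomial is scaled by `conj(det A)` under the `K_V`-letter `((A,D),(1,1))`.** -/
theorem linSubst_kV_placePoly_of_eq_iotaS (b : InfinitePlace L)
    (eA : Fin 2 ≃ PosIdx (cmXV L dV hdV ι₁ (cmPlacesEquiv L b))) (eS : Fin 2 ≃ NegIdx (cmXW L dV dW hdW ι₁ (cmPlacesEquiv L b)))
    (q₀ : NegIdx (cmXV L dV hdV ι₁ (cmPlacesEquiv L b))) [Subsingleton (NegIdx (cmXV L dV hdV ι₁ (cmPlacesEquiv L b)))]
    (hι : datum b = PlaceDatum.iota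
      ((pairFrame (PosIdx (cmXV L dV hdV ι₁ (cmPlacesEquiv L b))) (NegIdx (cmXV L dV hdV ι₁ (cmPlacesEquiv L b)))
        (PosIdx (cmXW L dV dW hdW ι₁ (cmPlacesEquiv L b))) (NegIdx (cmXW L dV dW hdW ι₁ (cmPlacesEquiv L b))) finProdFinEquiv
        (cmEpsV L dV hdV ι₁ (cmPlacesEquiv L b)) (cmEpsW L dV dW hdW ι₁ (cmPlacesEquiv L b))).symm ∘
        planeToDPIdxS eA eS q₀ (PosIdx (cmXW L dV dW hdW ι₁ (cmPlacesEquiv L b)))))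
    (A : Matrix.unitaryGroup (PosIdx (cmXV L dV hdV ι₁ (cmPlacesEquiv L b))) ℂ)
    (D : Matrix.unitaryGroup (NegIdx (cmXV L dV hdV ι₁ (cmPlacesEquiv L b))) ℂ)
    (m : ∀ b : InfinitePlace L, ((printPlaces (InfinitePlace L) (kindOf L dV hdV dW hdW ι₁ datum)
      (lamOf L dV hdV dW hdW ι₁ datum) (lamOf_ne_zero L dV hdV dW hdW ι₁ datum)
      (pinnedVacs (kindOf L dV hdV dW hdW ι₁ datum) m₁ m₂)).loc b).M) :
    linSubst (star ((reindexUnitary (pairFrame (PosIdx (cmXV L dV hdV ι₁ (cmPlacesEquiv L b))) (NegIdx (cmXV L dV hdV ι₁ (cmPlacesEquiv L b)))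
        (PosIdx (cmXW L dV dW hdW ι₁ (cmPlacesEquiv L b))) (NegIdx (cmXW L dV dW hdW ι₁ (cmPlacesEquiv L b))) finProdFinEquiv
        (cmEpsV L dV hdV ι₁ (cmPlacesEquiv L b)) (cmEpsW L dV dW hdW ι₁ (cmPlacesEquiv L b)))
        (dualPairι (((A, D), (1, 1)) : DPK (PosIdx (cmXV L dV hdV ι₁ (cmPlacesEquiv L b))) (NegIdx (cmXV L dV hdV ι₁ (cmPlacesEquiv L b)))
          (PosIdx (cmXW L dV dW hdW ι₁ (cmPlacesEquiv L b))) (NegIdx (cmXW L dV dW hdW ι₁ (cmPlacesEquiv L b))))) :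
          Matrix.unitaryGroup (Fin 6) ℂ) : Matrix (Fin 6) (Fin 6) ℂ))
        (placePoly L dV hdV dW hdW ι₁ datum m₁ m₂ m (cmPlacesEquiv L b)) =
      (Matrix.of fun a c : Fin 2 => star ((A : Matrix _ _ ℂ) (eA c) (eA a))).det • placePoly L dV hdV dW hdW ι₁ datum m₁ m₂ m (cmPlacesEquiv L b) := by
  rw [placePoly_apply]
  refine linSubst_emb_of_eq_iota L dV hdV dW hdW ι₁ _ _ _ _ ?_ (datum b) hι _ (m b)
  rw [← rename_rename, linSubst_star_reindexUnitary_rename, linSubst_star_dualPairι_kV_S_rename_detZ, map_smul]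

end Datum

end HodgeCM.Model.HypCensus

end
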